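import Summits.QuantumFields.BalabanUV.T4Continuum.Spine.NE3.RemainderL1FinalB8
import HarnessLib

/-!
# Support | NE7 (gen 96, ROAD-G96 §7, brick (Γ1)-ℓ¹): NE3's QUADRATIC ℓ¹ LETTER OF THE STRAIGHT TOWER **WITHOUT THE FRAME CONDITION (1.37)** —
# `dirL1 (linCovIter L W (Ad_W Z) (j+1) − logCovIter L W (Ad_W Z) (j+1)) (periodBox N) ≤ 64·C₁L²·d(4L+1)^d·((L∕L^d)·L)^{j}·l2sq Z`
# (the k-fold linearised double-bar average of `Z` equals the TOP NONLINEAR DOUBLE-BAR FIELD up to a k-free quadratic ℓ¹ error; at d = 4 the rate is `L²·M⁻²`)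

Cell `pub-balaban`, rung (B)+1 sub-cell t4, lineage `b2b-balaban-t4-ne7-p1` (CRUX PROVER NE7 #1 = OWNER of row NE7), generation 96; memo
`t4/b2b-balaban-t4-ne7-p1-g96/ROAD-G96.md` §7 (ROAD-Γ).  This is `Spine/NE3/RemainderL1FinalB8.dirL1_QbarIter_le_quadratic` (seat ne3, census R26′; inputs BY NAME:
`RemainderTelescopeB8.linCovIter_sub_logCovIter_eq_sum`, `RemainderL1TowerB8.dirL1_QbarIter_le`, `RemainderSumsStepB8.sum_norm_Ccov_le`,
`RemainderTowerLevelsB8.sqrt_l2sq_logCovIter_le`, `QbarTowerB8.linCovIter_adField`) with its ONLY use of the hypothesis `hdbar : dbavgCovIter L W (e^{Ad_W Z}) (j+1) = 1`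
— zeroing the top nonlinear field `logCovIter … (j+1)` in the telescope — REMOVED: the top field is KEPT on the left-hand side.  The proof is the R26′ proof verbatim up to that
line (re-issued here, not imported, because the original fixes the endpoint inside one `theorem`); it is also row NE3's listed item (M3) («tower re-issue with a budget», census §17)
in its sharpest, budget-free form.

WHY (memo §§1, 4, 7).  The NE7 record's last per-pair binder `hdecomp♭` reduces to the ℓ¹ letter (DL1) of the linearised top average of the slice representative `X₀` of an ARBITRARY
competitor; in the `T_♮`-gauge on the fibre `D X₀ = Qbar_top X₀`.  Gen 96's analysis and numerics (kit j333894∕j333900–2) show that the ONLY part of `Qbar_top X₀` that is not k-free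
bounded by the energy is a TOP PURE GAUGE — the second-order accumulated corner charge `γ ≈ ½Σ_{i<j}[c_i, c_j]` of a multi-scale competitor (coherent charges give `‖γ‖ ~ log M ×`
energy) — and that this part is annihilated by the coarse multiplier (`dS` kills pure gauges).  In the double-bar bookkeeping of [Balaban1985Averaging] that pure gauge is EXACTLY the
top nonlinear double-bar field `logCovIter_top = log U̿′^{k}` (at a pair with common plain average `U̿′^{k} = V^{g⁻¹}V⁻¹`, `g` = accumulated frame — `QbarTowerB8Budget.dbavgCovIter_eq_of_rep_pair`,
`PairFrameCondition.dbar_iff_stab_pair`), and THIS FILE says the rest is k-free quadratic in ℓ¹ with NO frame normalisation at all: the successor's supplier splits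
`Qbar_top X₀ = (top double-bar field) + (this file's remainder)`, feeds the remainder to the right inverse (κ-letter, k-free) and removes the top double-bar field by a top-corner
gauge adjustment (third-order residues, `M⁻²`-suppressed letters).
WHAT ([folklore]; 0 def, 0 sorry): **`dirL1_linCovIter_sub_logCovIter_le`** (start frame) and **`dirL1_QbarIter_sub_le`** (end frame: `QbarIter L (j+1) W Z` minus
`Ad_{Ū^{j+1}}⁻¹` of the top field), same constant and hypotheses as the NE3 original minus `hdbar`.
HONEST FRAMING (page 1): lattice kinematics of the averaging tower on OUR frame, re-issue of a kernel theorem of row NE3; nothing of Bałaban's asserted; (DL1), `hdecomp♭`, NE7, NE3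
NOT proved; spine 0∕9; finite T⁴ rung (B)+1 — NOT infinite volume, NOT mass gap, NOT `BetaPertH`, NOT Clay.  Continuum YM on T⁴ ⇐ BetaPertH ∧ nine spine estimates (0/9 proved);
BetaPertH ⇐ (D1) ∧ (D4) ∧ CAP+tail; G-an2-4 gates asym, D1 and NE2/3/4.
-/

set_option autoImplicit false

open scoped BigOperators Matrix.Norms.L2Operator
open NormedSpace Finset

namespace Summit.QuantumFields.BalabanUV.T4Continuum.NE7QbarIterL1DbarFree

open Literature.MathematicalPhysics.QuantumFieldTheory.Balaban1983to89
open B7Prop1Explicit B7Prop2Explicit B7Prop3Flat MatrixLog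
open B7Prop3GeneralLinear (Ccov linQcov Qcov)
open B7Prop4GeneralLevels (logCovIter linCovIter)
open B7Eq123General (prop4_general level_data blockLoops_of_pdev dbavgCovIter_eq_expCfg_logCovIter)
open B7Eq92Concrete (dbavgCovIter)
open B12Ineq417Flat (shiftCfg shiftCfg_apply)
open B7AvgPeriodicity (periodic_of_coord logCovIter_periodic linCovIter_periodic Qcov_periodic)
open T4AveragingDeficitWall (IsSkewDir IsUnitaryCfg SmallField Ad dirSq)
open T4AveragingDeficitWallBoundary (IsPeriodicCfg periodBox)
open AveragingDeficitPeriodicCounting (IsPeriodicDir)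
open AveragingDeficitChartCalculus (cavg)
open AveragingDeficitMultiLevelPrep (cavgIter LevelSmall radIter tower cavgIter_unitary_small isPeriodicCfg_cavgIter prop1Radius_nonneg)
open AveragingDeficitTwoLevelPrep (prop1Radius)
open AveragingDeficitMultiLevelBridge (cavgIter_eq_avgIter)
open AveragingDeficitTransport (norm_Ad_of_unitary)
open AveragingDeficitNearIdentity (Ad_one Ad_add Ad_neg)
open T4AveragingDeficitNonAbelian (Ad_mul)
open NE3TangentCovariantTower (QbarIter)
open NE3CovariantLineSumsL2 (l2sq l2sq_nonneg sqrt_l2sq_add_le)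
open NE3FramePotBoundW (tower_eq_pow_mul levelSmall_of_le)
open NE3FramePotBoundWClass (l2sq_QbarIter_le_class)
open NE3.QbarDictionary (adField)
open NE3.QbarTowerB8 (linCovIter_adField)
open NE3.RemainderTowerPrepB8 (shiftCfg_of_isPeriodicCfg shiftCfg_of_isPeriodicDir l2sq_adField levelSmall_radIter)
open NE3.RemainderTowerLevelsB8 (sqrt_l2sq_logCovIter_le)
open NE3.RemainderL1TowerB8 (dirL1_QbarIter_le dirL1_add_le' dirL1_nonneg')
open NE3.RemainderSumsStepB8 (sum_norm_Ccov_le)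
open NE3.RemainderTowerArith (geom_sum_L_le)
open ReplicationRightInverseBound (radSum radSum_nonneg)
open BlockAverageVaryHolo (nbRad)
open NE3CovariantLineSumsError (Csup Csup_nonneg)
open T4AveragingDeficitWall (dirL1)
open NE3.RemainderTelescopeB8 (linCovIter_sub_logCovIter_eq_sum linCovIter_one)
open ShellMeasureAverageProp4General (C1cov C1cov_pos)

open NE3.RemainderL1FinalB8 (dirL1_adField dirL1_finset_sum_le dirL1_neg radSum_mono radSum_radIter_le)

noncomputable section

variable {d : ℕ} {n : Type*} [Fintype n] [DecidableEq n]

/-! ## §1 The quadratic ℓ¹ letter with the top double-bar field kept (start frame) -/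

/-- **NE3's QUADRATIC ℓ¹ LETTER OF THE STRAIGHT TOWER WITHOUT THE FRAME CONDITION** (row Y9's tower class at `W`: unitary, `(N·L^{j+1})`-periodic, `0 ≤ x`,
`LevelSmall d L j x`, `SmallField W x`; Prop. 4's regime `(α₀, b)` with `pdev W < α₀(L^{j+1})⁻²`, `‖Z‖ ≤ b`, the lines `hsmall`, `hc₃`, `hK`, `hS1` of the original; `Z`
`(N·L^{j+1})`-periodic; NO `dbar`):
`dirL1 (linCovIter L W (Ad_W Z) (j+1) − logCovIter L W (Ad_W Z) (j+1)) (periodBox N) ≤ 64·C₁L²d(4L+1)^d·((L∕L^d)·L)^{j}·l2sq Z` —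
the telescope `RemainderTelescopeB8.linCovIter_sub_logCovIter_eq_sum` with its top term KEPT, then level by level the ℓ¹ tower from `Ū^{i+1}`, the quadratic one-step remainder
`sum_norm_Ccov_le` and the level size `sqrt_l2sq_logCovIter_le`, exactly as in `RemainderL1FinalB8.dirL1_QbarIter_le_quadratic`. [folklore] -/
theorem dirL1_linCovIter_sub_logCovIter_le [Nonempty n] {L N : ℕ} (hL : 2 ≤ L) (hN : 1 ≤ N) (j : ℕ)
    {W : Site d → Fin d → (Matrix n n ℂ)ˣ} {x : ℝ} (hWu : IsUnitaryCfg W) (hWP : IsPeriodicCfg W ((N * L ^ (j + 1) : ℕ) : ℤ))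
    (hx : 0 ≤ x) (hsm : LevelSmall d L j x) (hWx : SmallField W x)
    {α₀ b : ℝ} (hα : 0 < α₀) (hα3 : C0 d * (2 * α₀) ≤ 1 / 3) (hα4 : 4 * (2 * α₀) ≤ c2' d L)
    (h52 : pdev W < α₀ * (((L : ℝ) ^ (j + 1))⁻¹) ^ 2) (hb : 0 ≤ b)
    {Z : Site d → Fin d → Matrix n n ℂ} (hZ : ∀ (y : Site d) (κ : Fin d), ‖Z y κ‖ ≤ b) (hZP : IsPeriodicDir Z ((N * L ^ (j + 1) : ℕ) : ℤ))
    (hsmall : Real.exp (4 * (800 * ((d : ℝ) + 1) ^ 2 * ((d : ℝ) + 4)) * α₀)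
      * (1 + 8 * (131072 * ((d : ℝ) + 1) ^ 2) * ((L : ℝ) ^ (j + 1) * b)) ≤ 2)
    (hc₃ : 4 * ((L : ℝ) ^ (j + 1) * b) ≤ c3 d L)
    (hK : 16 * (C1cov d * (L : ℝ) ^ 2 * Real.sqrt (d * (2 * (2 * L) + 1) ^ d)) * (L : ℝ) ^ (j + 1) * b ≤ Real.sqrt ((L : ℝ) ^ 2 / (L : ℝ) ^ d))
    (hS1 : (16 * (d + 1) * (d + 4) * (L : ℝ) ^ 2 * Csup d L * (d * (2 * nbRad d L + 1) ^ d)) * radSum d L j x ≤ ((L : ℝ) / (L : ℝ) ^ d) / 2) :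
    dirL1 (linCovIter L W (adField W Z) (j + 1) - logCovIter L W (adField W Z) (j + 1)) (periodBox (d := d) N)
      ≤ 64 * (C1cov d * (L : ℝ) ^ 2 * (d * (2 * (2 * (L : ℝ)) + 1) ^ d)) * (((L : ℝ) / (L : ℝ) ^ d) * L) ^ (j + 1 - 1)
          * l2sq (periodBox (d := d) (N * L ^ (j + 1))) Z := by
  letI : CStarAlgebra (Matrix n n ℂ) := {}
  have hL1 : 1 ≤ L := by omega
  have hL0 : (0 : ℝ) < L := by exact_mod_cast (show 0 < L by omega)
  have hLR : (2 : ℝ) ≤ L := by exact_mod_cast hL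
  set k : ℕ := j + 1 with hk
  -- the fine field `B = Ad_W Z` and the regime data
  set B : Site d → Fin d → Matrix n n ℂ := adField W Z with hBdef
  have hBsup : ∀ (y : Site d) (κ : Fin d), ‖B y κ‖ ≤ b := fun y κ => by
    rw [hBdef]; unfold adField; rw [norm_Ad_of_unitary (hWu y κ)]; exact hZ y κ
  have hG := avgClosed_unitaryUnits d (𝔸 := Matrix n n ℂ) L
  have hU₀ : ∀ (y : Site d) (κ : Fin d), W y κ ∈ unitaryUnits (Matrix n n ℂ) := hWu
  have hα3' : C0 d * α₀ ≤ 1 / 3 := by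
    have hC : 0 ≤ C0 d := by unfold C0; positivity
    nlinarith
  have hα4' : 4 * α₀ ≤ c2' d L := by linarith
  have hc₃' : 2 * ((L : ℝ) ^ k * b) ≤ c3 d L := by rw [hk]; nlinarith [pow_pos hL0 (j + 1)]
  have h4 := prop4_general L hL hG k W hU₀ hα hα3' hα4' h52 B hb hBsup hsmall hc₃'
  have hld := level_data L hL hG k W hU₀ hα hα3' hα4' h52
  -- loops of every averaged background below the top
  have hloopsW : ∀ i < k, ∀ (z : Site d) (κ : Fin d) (r : Fin d → Fin L),
      ‖((Wcx L (cavgIter L i W) ((L : ℤ) • z) κ (boxVec L r) : (Matrix n n ℂ)ˣ) : Matrix n n ℂ) - 1‖ < 1 := by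
    intro i hi z κ r
    obtain ⟨hV, hβ0, hβ, hβmax⟩ := hld i hi.le
    rw [cavgIter_eq_avgIter]
    have h := blockLoops_of_pdev hL1 hV hβ0 hβ hβmax ((L : ℤ) • z) κ
    exact ((h.1 r).trans h.2).trans_lt (by norm_num)
  -- periodicity bookkeeping: `L^i · (N·L^{k−i}) = N·L^k`
  have hPk : ∀ i ≤ k, L ^ i * (N * L ^ (k - i)) = N * L ^ k := by
    intro i hi
    rw [mul_left_comm, ← pow_add, Nat.add_sub_cancel' hi]
  have hWsh : ∀ a : Site d, shiftCfg (((N * L ^ k : ℕ) : ℤ) • a) W = W := shiftCfg_of_isPeriodicCfg hWP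
  have hBP : IsPeriodicDir B ((N * L ^ k : ℕ) : ℤ) := by
    intro y i μ; rw [hBdef]; unfold adField; rw [hWP y i μ, hZP y i μ]
  have hBsh : ∀ a : Site d, shiftCfg (((N * L ^ k : ℕ) : ℤ) • a) B = B := shiftCfg_of_isPeriodicDir hBP
  -- the nonlinear iterates: sup (Prop. 4) and periodicity
  have hAsup : ∀ i ≤ k, ∀ (y : Site d) (κ : Fin d), ‖logCovIter L W B i y κ‖ ≤ 2 * ((L : ℝ) ^ i * b) :=
    fun i hi => (h4 i hi).2
  have hAP : ∀ i ≤ k, ∀ (y : Site d) (κ μ : Fin d),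
      logCovIter L W B i (y + ((N * L ^ (k - i) : ℕ) : ℤ) • e κ) μ = logCovIter L W B i y μ := by
    intro i hi y κ μ
    have hT : ∀ a : Site d, shiftCfg ((((L : ℤ) ^ i) * ((N * L ^ (k - i) : ℕ) : ℤ)) • a) W = W := by
      intro a
      have e : ((L : ℤ) ^ i) * ((N * L ^ (k - i) : ℕ) : ℤ) = ((N * L ^ k : ℕ) : ℤ) := by
        rw [← hPk i hi]; push_cast; ring
      rw [e]; exact hWsh a
    have hT' : ∀ a : Site d, shiftCfg ((((L : ℤ) ^ i) * ((N * L ^ (k - i) : ℕ) : ℤ)) • a) B = B := by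
      intro a
      have e : ((L : ℤ) ^ i) * ((N * L ^ (k - i) : ℕ) : ℤ) = ((N * L ^ k : ℕ) : ℤ) := by
        rw [← hPk i hi]; push_cast; ring
      rw [e]; exact hBsh a
    exact logCovIter_periodic L W B i hT hT' (e κ) y μ
  -- per-level averaged backgrounds: pointwise periodicity
  have hVP : ∀ i ≤ k, IsPeriodicCfg (cavgIter L i W) ((N * L ^ (k - i) : ℕ) : ℤ) := by
    intro i hi
    refine isPeriodicCfg_cavgIter L (N * L ^ (k - i)) i ?_
    rw [tower_eq_pow_mul, hPk i hi]; exact hWP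
  -- the one-step remainder fields
  set Cf : ℕ → Site d → Fin d → Matrix n n ℂ :=
    fun i z κ => Ccov L (avgIter L W i) (logCovIter L W B i) ((L : ℤ) • z) κ with hCf
  -- periodicity of the one-step remainder fields: `Cf i` is `(N·L^{k−(i+1)})`-periodic for `i < k`
  have hCfP : ∀ i < k, IsPeriodicDir (Cf i) ((N * L ^ (k - (i + 1)) : ℕ) : ℤ) := by
    intro i hi z κ' μ
    have hP1 : L ^ 1 * (N * L ^ (k - (i + 1))) = N * L ^ (k - i) := by
      rw [pow_one, mul_left_comm, ← pow_succ']; congr 2; omega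
    have hVsh : ∀ a : Site d, shiftCfg ((((L : ℤ) ^ 1) * ((N * L ^ (k - (i + 1)) : ℕ) : ℤ)) • a) (avgIter L W i) = avgIter L W i := by
      intro a
      have e : ((L : ℤ) ^ 1) * ((N * L ^ (k - (i + 1)) : ℕ) : ℤ) = ((N * L ^ (k - i) : ℕ) : ℤ) := by
        rw [← hP1]; push_cast; ring
      rw [e, ← cavgIter_eq_avgIter]; exact shiftCfg_of_isPeriodicCfg (hVP i hi.le) a
    have hAsh : ∀ a : Site d, shiftCfg ((((L : ℤ) ^ 1) * ((N * L ^ (k - (i + 1)) : ℕ) : ℤ)) • a) (logCovIter L W B i) = logCovIter L W B i := by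
      intro a
      have e : ((L : ℤ) ^ 1) * ((N * L ^ (k - (i + 1)) : ℕ) : ℤ) = ((N * L ^ (k - i) : ℕ) : ℤ) := by
        rw [← hP1]; push_cast; ring
      rw [e]; exact shiftCfg_of_isPeriodicDir (fun y κ μ => hAP i hi.le y κ μ) a
    -- the remainder is `Q − L(Q·)`; both are periodic
    have hQ : Qcov L (avgIter L W i) (logCovIter L W B i) ((L : ℤ) • (z + ((N * L ^ (k - (i + 1)) : ℕ) : ℤ) • e κ')) μ
        = Qcov L (avgIter L W i) (logCovIter L W B i) ((L : ℤ) • z) μ := by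
      have e1 : (L : ℤ) • (z + ((N * L ^ (k - (i + 1)) : ℕ) : ℤ) • e κ') = (L : ℤ) • z + (((N * L ^ (k - i) : ℕ) : ℤ)) • e κ' := by
        rw [smul_add, smul_smul, ← hP1]; push_cast; ring_nf
      rw [e1]
      refine Qcov_periodic L _ _ ?_ ?_ _ μ
      · rw [← cavgIter_eq_avgIter]
        have := shiftCfg_of_isPeriodicCfg (hVP i hi.le) (e κ')
        exact this
      · exact shiftCfg_of_isPeriodicDir (fun y κ μ => hAP i hi.le y κ μ) (e κ')
    have hLin : linQcov L (avgIter L W i) (logCovIter L W B i) ((L : ℤ) • (z + ((N * L ^ (k - (i + 1)) : ℕ) : ℤ) • e κ')) μ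
        = linQcov L (avgIter L W i) (logCovIter L W B i) ((L : ℤ) • z) μ := by
      rw [← linCovIter_one, ← linCovIter_one]
      exact linCovIter_periodic L (avgIter L W i) (logCovIter L W B i) 1 hVsh hAsh (e κ') z μ
    simp only [hCf, Ccov, hQ, hLin]
  -- the level sizes (step 2b-γ) and the top: `A_k = 0`
  have hlev := sqrt_l2sq_logCovIter_le hL hN j hWu hWP hx hsm hWx hα hα3 hα4 h52 hb hZ hZP hsmall hc₃ hK
  -- the telescope WITH the top nonlinear field kept (no `dbar`): `L(B)_k − A_k = −Σ_i L^{[k←i+1]}(C_i)`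
  have hlin : linCovIter L W B k - logCovIter L W B k
      = -∑ i ∈ Finset.range k, linCovIter L (avgIter L W (i + 1)) (Cf i) (k - (i + 1)) :=
    linCovIter_sub_logCovIter_eq_sum L hL hG k W hU₀ hα hα3 hα4 h52 B
  -- per term: the ℓ¹ tower from `Ū₀^{i+1}`, then the quadratic one-step remainder, then the level size
  set r : ℝ := (L : ℝ) / (L : ℝ) ^ d with hrdef
  set ρ2 : ℝ := (L : ℝ) ^ 2 / (L : ℝ) ^ d with hρ2def
  have hr0' : 0 ≤ r := by rw [hrdef]; positivity
  have hρ20 : 0 ≤ ρ2 := by rw [hρ2def]; positivity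
  have hrρ : ρ2 = r * L := by rw [hρ2def, hrdef]; field_simp
  set K1' : ℝ := C1cov d * (L : ℝ) ^ 2 * (d * (2 * (2 * (L : ℝ)) + 1) ^ d) with hK1'
  have hK1'0 : 0 ≤ K1' := by rw [hK1']; have := C1cov_pos d; positivity
  set β2 : ℝ := l2sq (periodBox (d := d) (N * L ^ k)) Z with hβ2
  have hβ20 : 0 ≤ β2 := l2sq_nonneg _ _
  have hterm : ∀ i ∈ Finset.range k,
      dirL1 (linCovIter L (avgIter L W (i + 1)) (Cf i) (k - (i + 1))) (periodBox (d := d) N) ≤ 32 * K1' * β2 * r ^ (k - 1) * (L : ℝ) ^ i := by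
    intro i hi
    have hik : i < k := Finset.mem_range.mp hi
    -- (a) the quadratic ℓ¹ size of `Cf i`
    obtain ⟨hV, hβ0', hβ', hβmax'⟩ := hld i hik.le
    have hN₁ : 1 ≤ N * L ^ (k - (i + 1)) := Nat.one_le_iff_ne_zero.mpr (Nat.mul_ne_zero (by omega) (pow_ne_zero _ (by omega)))
    have hLN : L * (N * L ^ (k - (i + 1))) = N * L ^ (k - i) := by
      rw [mul_left_comm, ← pow_succ']; congr 2; omega
    have hLi : (L : ℝ) ^ i ≤ (L : ℝ) ^ k := pow_le_pow_right₀ (by linarith) hik.le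
    have ha0 : 0 ≤ 2 * ((L : ℝ) ^ i * b) := by positivity
    have hac : 2 * ((L : ℝ) ^ i * b) ≤ c3 d L / 2 := by nlinarith [mul_le_mul_of_nonneg_right hLi hb]
    have hAP' : ∀ (y : Site d) (κ μ : Fin d),
        logCovIter L W B i (y + ((L * (N * L ^ (k - (i + 1))) : ℕ) : ℤ) • e κ) μ = logCovIter L W B i y μ := by
      rw [hLN]; exact hAP i hik.le
    have hC1 := sum_norm_Ccov_le hL1 hV hβ0' hβ' hβmax' hN₁ (logCovIter L W B i) ha0 (hAsup i hik.le) hac hAP'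
    rw [hLN] at hC1
    have hAi := hlev i hik.le
    have hAi2 : l2sq (periodBox (d := d) (N * L ^ (k - i))) (logCovIter L W B i) ≤ (4 * Real.sqrt ρ2 ^ i) ^ 2 * β2 := by
      have h0 : 0 ≤ l2sq (periodBox (d := d) (N * L ^ (k - i))) (logCovIter L W B i) := l2sq_nonneg _ _
      have h1 := pow_le_pow_left₀ (Real.sqrt_nonneg _) hAi 2
      rw [Real.sq_sqrt h0, mul_pow, Real.sq_sqrt hβ20] at h1
      rw [hBdef] at h1 ⊢
      exact h1
    have hρi : (Real.sqrt ρ2 ^ i) ^ 2 = ρ2 ^ i := by rw [← pow_mul, mul_comm, pow_mul, Real.sq_sqrt hρ20]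
    have hCf1 : dirL1 (Cf i) (periodBox (d := d) (N * L ^ (k - (i + 1)))) ≤ K1' * (16 * ρ2 ^ i * β2) := by
      have e : dirL1 (Cf i) (periodBox (d := d) (N * L ^ (k - (i + 1))))
          = ∑ z ∈ periodBox (d := d) (N * L ^ (k - (i + 1))), ∑ κ : Fin d, ‖Ccov L (avgIter L W i) (logCovIter L W B i) ((L : ℤ) • z) κ‖ := rfl
      rw [e]
      refine hC1.trans ?_
      have e2 : (4 * Real.sqrt ρ2 ^ i) ^ 2 * β2 = 16 * ρ2 ^ i * β2 := by rw [mul_pow, hρi]; norm_num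
      rw [e2] at hAi2
      have := mul_le_mul_of_nonneg_left hAi2 hK1'0
      refine le_trans (le_of_eq ?_) this
      rw [hK1']; unfold l2sq; ring
    -- (b) the ℓ¹ propagation from `Ū₀^{i+1}`
    set m : ℕ := k - (i + 1) with hm
    have hprop : dirL1 (linCovIter L (avgIter L W (i + 1)) (Cf i) m) (periodBox (d := d) N)
        ≤ 2 * r ^ m * dirL1 (Cf i) (periodBox (d := d) (N * L ^ m)) := by
      rcases Nat.eq_zero_or_pos m with hm0 | hmpos
      · rw [hm0, pow_zero, pow_zero, mul_one, Nat.mul_one, show linCovIter L (avgIter L W (i + 1)) (Cf i) 0 = Cf i from rfl]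
        have := dirL1_nonneg' (Cf i) (periodBox (d := d) N)
        linarith
      · obtain ⟨m', hm'⟩ : ∃ m', m = m' + 1 := ⟨m - 1, by omega⟩
        have hi'j : i + 1 ≤ j := by omega
        obtain ⟨hW'u, hr0, hW'x⟩ := cavgIter_unitary_small hL1 i hWu hx (levelSmall_of_le (by omega) hsm) hWx
        have hsm' : LevelSmall d L m' (radIter d L (i + 1) x) := by
          refine levelSmall_of_le (by omega) (levelSmall_radIter (i + 1) (j - (i + 1)) ?_)
          rw [Nat.add_sub_cancel' hi'j]; exact hsm
        have htw : tower L N (m' + 1) = N * L ^ (k - (i + 1)) := by rw [tower_eq_pow_mul, Nat.mul_comm, ← hm', hm]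
        have hW'P : IsPeriodicCfg (cavgIter L (i + 1) W) ((tower L N (m' + 1) : ℕ) : ℤ) := by rw [htw]; exact hVP (i + 1) hik
        have hCfP' : IsPeriodicDir (Cf i) ((tower L N (m' + 1) : ℕ) : ℤ) := by rw [htw]; exact hCfP i hik
        have hloops' : ∀ i'' < m' + 1, ∀ (z : Site d) (κ : Fin d) (rr : Fin d → Fin L),
            ‖((Wcx L (cavgIter L i'' (cavgIter L (i + 1) W)) ((L : ℤ) • z) κ (boxVec L rr) : (Matrix n n ℂ)ˣ) : Matrix n n ℂ) - 1‖ < 1 := by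
          intro i'' hi'' z κ rr
          have e : cavgIter L i'' (cavgIter L (i + 1) W) = cavgIter L (i + 1 + i'') W := by
            rw [cavgIter_eq_avgIter, cavgIter_eq_avgIter, cavgIter_eq_avgIter, ← B9Eq315QTower.avgIter_add]
          rw [e]; exact hloopsW (i + 1 + i'') (by omega) z κ rr
        have hS' : (16 * (d + 1) * (d + 4) * (L : ℝ) ^ 2 * Csup d L * (d * (2 * nbRad d L + 1) ^ d)) * radSum d L m' (radIter d L (i + 1) x)
            ≤ ((L : ℝ) / (L : ℝ) ^ d) / 2 := by
          refine le_trans (mul_le_mul_of_nonneg_left (radSum_radIter_le (d := d) (L := L) (i + 1) j m' (by omega) hx) ?_) hS1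
          have := Csup_nonneg d L; positivity
        -- dictionary: `linCovIter W′ (Ad_{W′} Y′) = Ad (QbarIter W′ Y′)` with `Y′ = Ad_{W′}⁻¹ (Cf i)`
        set Y' : Site d → Fin d → Matrix n n ℂ := fun y μ => Ad ((cavgIter L (i + 1) W) y μ)⁻¹ (Cf i y μ) with hY'
        have hYY : Cf i = adField (cavgIter L (i + 1) W) Y' := (NE3.RemainderTowerPrepB8.adField_inv _ _).symm
        have hY'P : IsPeriodicDir Y' ((tower L N (m' + 1) : ℕ) : ℤ) := by
          intro y ii μ; simp only [hY', hW'P y ii μ, hCfP' y ii μ]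
        have hVm : IsUnitaryCfg (cavgIter L (m' + 1) (cavgIter L (i + 1) W)) := (cavgIter_unitary_small hL1 m' hW'u hr0 hsm' hW'x).1
        have htow := dirL1_QbarIter_le hL1 hN m' hW'u hW'P hr0 hsm' hW'x hS' hY'P
        rw [← hrdef] at htow
        have hdict' : linCovIter L (cavgIter L (i + 1) W) (adField (cavgIter L (i + 1) W) Y') (m' + 1)
            = adField (cavgIter L (m' + 1) (cavgIter L (i + 1) W)) (QbarIter L (m' + 1) (cavgIter L (i + 1) W) Y') :=
          linCovIter_adField L _ Y' (m' + 1) hloops'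
        have hgoal : dirL1 (linCovIter L (cavgIter L (i + 1) W) (Cf i) (m' + 1)) (periodBox (d := d) N)
            ≤ 2 * r ^ (m' + 1) * dirL1 (Cf i) (periodBox (d := d) (tower L N (m' + 1))) := by
          rw [hYY, hdict', dirL1_adField hVm, dirL1_adField hW'u]
          exact htow
        have htw' : tower L N (m' + 1) = N * L ^ (m' + 1) := by rw [tower_eq_pow_mul, Nat.mul_comm]
        rw [cavgIter_eq_avgIter, htw'] at hgoal
        rw [hm']
        exact hgoal
    -- (c) combine
    have hkm : k - 1 - i = m := by omega
    calc dirL1 (linCovIter L (avgIter L W (i + 1)) (Cf i) (k - (i + 1))) (periodBox (d := d) N)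
        ≤ 2 * r ^ m * dirL1 (Cf i) (periodBox (d := d) (N * L ^ m)) := hprop
      _ ≤ 2 * r ^ m * (K1' * (16 * ρ2 ^ i * β2)) := mul_le_mul_of_nonneg_left hCf1 (mul_nonneg zero_le_two (pow_nonneg hr0' m))
      _ = 32 * K1' * β2 * (r ^ m * ρ2 ^ i) := by ring
      _ = 32 * K1' * β2 * r ^ (k - 1) * (L : ℝ) ^ i := by
          rw [hrρ, mul_pow, ← hkm]
          have e : r ^ (k - 1 - i) * (r ^ i * (L : ℝ) ^ i) = r ^ (k - 1) * (L : ℝ) ^ i := by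
            rw [← mul_assoc, ← pow_add, Nat.sub_add_cancel (by omega)]
          rw [e]; ring
  -- sum over the levels
  have hgeo := geom_sum_L_le hLR k
  calc dirL1 (linCovIter L W B k - logCovIter L W B k) (periodBox (d := d) N)
      = dirL1 (∑ i ∈ Finset.range k, linCovIter L (avgIter L W (i + 1)) (Cf i) (k - (i + 1))) (periodBox (d := d) N) := by
        rw [hlin, dirL1_neg]
    _ ≤ ∑ i ∈ Finset.range k, dirL1 (linCovIter L (avgIter L W (i + 1)) (Cf i) (k - (i + 1))) (periodBox (d := d) N) :=
        dirL1_finset_sum_le _ _ _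
    _ ≤ ∑ i ∈ Finset.range k, 32 * K1' * β2 * r ^ (k - 1) * (L : ℝ) ^ i := Finset.sum_le_sum hterm
    _ = 32 * K1' * β2 * r ^ (k - 1) * ∑ i ∈ Finset.range k, (L : ℝ) ^ i := by rw [Finset.mul_sum]
    _ ≤ 32 * K1' * β2 * r ^ (k - 1) * (2 * (L : ℝ) ^ (k - 1)) :=
        mul_le_mul_of_nonneg_left hgeo (mul_nonneg (mul_nonneg (mul_nonneg (by norm_num) hK1'0) hβ20) (pow_nonneg hr0' _))
    _ = 64 * K1' * (r * L) ^ (k - 1) * β2 := by rw [mul_pow]; ring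
    _ = 64 * (C1cov d * (L : ℝ) ^ 2 * (d * (2 * (2 * (L : ℝ)) + 1) ^ d)) * (((L : ℝ) / (L : ℝ) ^ d) * L) ^ (j + 1 - 1)
          * l2sq (periodBox (d := d) (N * L ^ (j + 1))) Z := by rw [hK1', hrdef, hβ2, hk]



/-! ## §2 The same in the END frame of the tower: `QbarIter` minus the transported top double-bar field -/

/-- **END-FRAMED FORM**: with `Ū := cavgIter L (j+1) W`, `dirL1 (z κ ↦ QbarIter L (j+1) W Z z κ − Ad (Ū z κ)⁻¹ (logCovIter L W (Ad_W Z) (j+1) z κ)) (periodBox N)` obeys the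
same bound (`linCovIter L W (Ad_W Z) (j+1) = Ad_{Ū}(QbarIter L (j+1) W Z)` by `QbarTowerB8.linCovIter_adField`, and `dirL1` is `Ad`-invariant).  With `hdbar` the subtracted field is
`0` and this is the NE3 original. [folklore] -/
theorem dirL1_QbarIter_sub_le [Nonempty n] {L N : ℕ} (hL : 2 ≤ L) (hN : 1 ≤ N) (j : ℕ)
    {W : Site d → Fin d → (Matrix n n ℂ)ˣ} {x : ℝ} (hWu : IsUnitaryCfg W) (hWP : IsPeriodicCfg W ((N * L ^ (j + 1) : ℕ) : ℤ))
    (hx : 0 ≤ x) (hsm : LevelSmall d L j x) (hWx : SmallField W x)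
    {α₀ b : ℝ} (hα : 0 < α₀) (hα3 : C0 d * (2 * α₀) ≤ 1 / 3) (hα4 : 4 * (2 * α₀) ≤ c2' d L)
    (h52 : pdev W < α₀ * (((L : ℝ) ^ (j + 1))⁻¹) ^ 2) (hb : 0 ≤ b)
    {Z : Site d → Fin d → Matrix n n ℂ} (hZ : ∀ (y : Site d) (κ : Fin d), ‖Z y κ‖ ≤ b) (hZP : IsPeriodicDir Z ((N * L ^ (j + 1) : ℕ) : ℤ))
    (hsmall : Real.exp (4 * (800 * ((d : ℝ) + 1) ^ 2 * ((d : ℝ) + 4)) * α₀)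
      * (1 + 8 * (131072 * ((d : ℝ) + 1) ^ 2) * ((L : ℝ) ^ (j + 1) * b)) ≤ 2)
    (hc₃ : 4 * ((L : ℝ) ^ (j + 1) * b) ≤ c3 d L)
    (hK : 16 * (C1cov d * (L : ℝ) ^ 2 * Real.sqrt (d * (2 * (2 * L) + 1) ^ d)) * (L : ℝ) ^ (j + 1) * b ≤ Real.sqrt ((L : ℝ) ^ 2 / (L : ℝ) ^ d))
    (hS1 : (16 * (d + 1) * (d + 4) * (L : ℝ) ^ 2 * Csup d L * (d * (2 * nbRad d L + 1) ^ d)) * radSum d L j x ≤ ((L : ℝ) / (L : ℝ) ^ d) / 2) :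
    dirL1 (fun z κ => QbarIter L (j + 1) W Z z κ
        - Ad ((cavgIter L (j + 1) W) z κ)⁻¹ (logCovIter L W (adField W Z) (j + 1) z κ)) (periodBox (d := d) N)
      ≤ 64 * (C1cov d * (L : ℝ) ^ 2 * (d * (2 * (2 * (L : ℝ)) + 1) ^ d)) * (((L : ℝ) / (L : ℝ) ^ d) * L) ^ (j + 1 - 1)
          * l2sq (periodBox (d := d) (N * L ^ (j + 1))) Z := by
  letI : CStarAlgebra (Matrix n n ℂ) := {}
  have hL1 : 1 ≤ L := by omega
  have h := dirL1_linCovIter_sub_logCovIter_le hL hN j hWu hWP hx hsm hWx hα hα3 hα4 h52 hb hZ hZP hsmall hc₃ hK hS1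
  -- loops of every averaged background below the top (for the dictionary)
  have hG := avgClosed_unitaryUnits d (𝔸 := Matrix n n ℂ) L
  have hU₀ : ∀ (y : Site d) (κ : Fin d), W y κ ∈ unitaryUnits (Matrix n n ℂ) := hWu
  have hα3' : C0 d * α₀ ≤ 1 / 3 := by
    have hC : 0 ≤ C0 d := by unfold C0; positivity
    nlinarith
  have hα4' : 4 * α₀ ≤ c2' d L := by linarith
  have hld := level_data L hL hG (j + 1) W hU₀ hα hα3' hα4' h52
  have hloopsW : ∀ i < j + 1, ∀ (z : Site d) (κ : Fin d) (r : Fin d → Fin L),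
      ‖((Wcx L (cavgIter L i W) ((L : ℤ) • z) κ (boxVec L r) : (Matrix n n ℂ)ˣ) : Matrix n n ℂ) - 1‖ < 1 := by
    intro i hi z κ r
    obtain ⟨hV, hβ0, hβ, hβmax⟩ := hld i hi.le
    rw [cavgIter_eq_avgIter]
    have h' := blockLoops_of_pdev hL1 hV hβ0 hβ hβmax ((L : ℤ) • z) κ
    exact ((h'.1 r).trans h'.2).trans_lt (by norm_num)
  have hVk : IsUnitaryCfg (cavgIter L (j + 1) W) := (cavgIter_unitary_small hL1 j hWu hx hsm hWx).1
  have hdict : linCovIter L W (adField W Z) (j + 1) = adField (cavgIter L (j + 1) W) (QbarIter L (j + 1) W Z) :=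
    linCovIter_adField L W Z (j + 1) hloopsW
  -- the end-framed field, conjugated back to the start frame, is `linCovIter − logCovIter`
  have hconj : adField (cavgIter L (j + 1) W) (fun z κ => QbarIter L (j + 1) W Z z κ
        - Ad ((cavgIter L (j + 1) W) z κ)⁻¹ (logCovIter L W (adField W Z) (j + 1) z κ))
      = linCovIter L W (adField W Z) (j + 1) - logCovIter L W (adField W Z) (j + 1) := by
    rw [hdict]
    funext z κ
    show Ad ((cavgIter L (j + 1) W) z κ) (QbarIter L (j + 1) W Z z κ
          - Ad ((cavgIter L (j + 1) W) z κ)⁻¹ (logCovIter L W (adField W Z) (j + 1) z κ))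
        = Ad ((cavgIter L (j + 1) W) z κ) (QbarIter L (j + 1) W Z z κ) - logCovIter L W (adField W Z) (j + 1) z κ
    rw [sub_eq_add_neg, Ad_add, Ad_neg, ← Ad_mul, mul_inv_cancel, Ad_one, ← sub_eq_add_neg]
  rw [← dirL1_adField hVk, hconj]
  exact h

end

end Summit.QuantumFields.BalabanUV.T4Continuum.NE7QbarIterL1DbarFree
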